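import Literature.AlgebraicGeometry.ShimuraVarieties.UnitaryConeDiscontinuity
import Literature.NumberTheory.Transcendental.AnalytificationLocalBiholomorphism
import Literature.NumberTheory.Automorphic.HilbertSiegelModularFormModN
import HarnessLib

/-!
# Local holomorphic sections of the uniformisation of a compact ball quotient through ANY analytification (any model space),
# and the SECTION DOMAINS covering it — with the Siegel lift read along the sections

Topic `AlgebraicGeometry/ShimuraVarieties`, namespace `Literature.AlgebraicGeometry.ShimuraVarieties` (grouping sub-namespace
`UnitaryBallUniformisationDatum`).  THEOREMS ONLY (no definition, no named fact, no instance, no notation, no `sorry`).  Sequel of ★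
`UnitaryBallUniformisationLocalSection` ∕ ★ `UnitaryConeDiscontinuity` (`exists_mdifferentiableAt_section`, `…'`, stated for a Hodge model
`A : HodgeModel p Y`, i.e. for the analytification carried by `A` on ITS model space `A.model`).  Cell `hodgecm-mathlib` (D-0151), FLOOR 0, P6
«MOD» (crux hLiu418 = stmt-HodgeConjecture-24832, `--supports`), E6 closer of `Cruxes/HLiu418/Lines/F0_P6a_PELWitnessE.lean`, socket Σ-AN
`ReadsCReading`, census row **COV-2 «P-3 inputs per piece»** (A-p06 (g33) `CENSUS-SigmaAN.v1`): the named fact ★ P-3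
`siegelUniversalFamilyUniformisation` is instantiated on an analytification `φT : MT → T(ℂ)` CHARTED ON `Fin d → ℂ` (its binders
`[ChartedSpace (Fin d → ℂ) MT]`, `hT : IsAnalytification (Fin d → ℂ) T d φT`), over opens `U ⊆ MT` carrying a holomorphic lift `s` of
`ψ^an` through `unif_c`; on a disc-quotient piece `T = X_q` such `U`, `s` come from holomorphic local sections `σ` of the ball uniformisation
`B.unif` (`s := Z ∘ σ`, `Z` the holomorphic Siegel period function of the slice, `unif_c (Z v) = ψ_q (B.unif v)` by ★ E6-fac).  The ★ section
lemma is typed on a `HodgeModel` (model space `A.model`, not `Fin d → ℂ`); this file proves it for an ARBITRARY analytification `(E, M, φ)`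
— the same Clements–Osgood argument, verbatim — and packages the section domains in the P-3 binder shape.  HC_CM is proved only modulo the
printed citations (2 remaining named inputs hLiu418 24832, h413 24833) until rung 0 closes; this file is generic and changes no count.

THE MATHEMATICS ([FritzscheGrauert2002] Ch. I §8; [BergeronMillsonMoeglin2016Balls] Introduction §1.1: `S(Γ) = Γ∖𝔹` is a complex manifold
and `𝔹 → S(Γ)` a local biholomorphism for torsion-free `Γ`).  `D : UnitaryBallUniformisationDatum p Y`, `φ : M → Y(ℂ)` an analytification of
`Y` with holomorphic atlas on a finite-dimensional `E`.  (§1) The lift `φ⁻¹ ∘ unif` is holomorphic on the negative cone (★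
`IsAnalytification.mdifferentiableAt_symm_comp`).  (§2) If `unif` is injective modulo `ℂˣ` near `v₀` then — restricting the lift to the affine
slice `v₀ + {e : e_{i₀} = 0}` transverse to `ℂ v₀`, an injective holomorphic map between `p`-dimensional manifolds near `0`, hence a local
biholomorphism (★ `SCV.isOpen_image_of_injOn`, ★ `SCV.differentiableOn_symm_of_differentiableOn`) — there are an open `W ∋ φ⁻¹(unif v₀)` and
`σ : M → ℂ^{p+1}`, complex-differentiable on `W`, with `σ (φ⁻¹(unif v₀)) = v₀`, `σ(W) ⊆ negCone`, `unif ∘ σ = φ` on `W`.  (§3) The hypothesis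
holds at every cone vector (★ `exists_isOpen_unif_eq_unif_imp_smul`, proper discontinuity), so sections exist through every `v₀`, and
(§4) through every point `t` of `M` (`unif` is onto).  (§5) Along a section, a function `Z` on the cone, entrywise holomorphic and
`𝔥_g`-valued, with `unif_c (Z v) = ψ (unif v)` (a Siegel lift of a morphism `ψ : Y → S_c`, ★ E6-fac), gives the P-3 lift `s := Z ∘ σ`:
entrywise `MDifferentiableOn` on `W`, `𝔥_g`-valued, `unif_c (s t) = ψ (φ t)`.

* §1 `mdifferentiableAt_symm_comp_unif_of_isAnalytification`, `mdifferentiableAt_symm_comp_unif_add_of_isAnalytification`.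
* §2 **`exists_mdifferentiableAt_section_of_isAnalytification`** (with `hinj`), §3 **`exists_mdifferentiableAt_section_of_isAnalytification'`**.
* §4 **`exists_section_nhds_of_isAnalytification`** — through every point of `M` (the `hcov` shape of ★ E6-an′).
* §5 **`exists_siegelLift_nhds_of_isAnalytification`** — the P-3 binder block `(U, IsOpen U, s, hs, hs_hol, hs_lift)` at every point, with
  the section data `(σ, MDifferentiableAt, unif ∘ σ = φ)` of ★ `SiegelPeriodLinearAvatarFamily.exists_clm_family_along_lift`.

## References
* [FritzscheGrauert2002] K. Fritzsche, H. Grauert, *From Holomorphic Functions to Complex Manifolds* (2002), Ch. I §8 Thm. 8.5, Cor. 8.6.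
* [SerreGAGA1956] J.-P. Serre, *GAGA*, Ann. Inst. Fourier 6 (1956), §2 n°5–6.
* [BergeronMillsonMoeglin2016Balls] N. Bergeron, J. Millson, C. Moeglin, Acta Math. 216 (2016), Introduction §1.1, Part 2 §1.3.
* [Borel1969] A. Borel, *Introduction aux groupes arithmétiques* (1969), Prop. 7.13 (proper discontinuity).
-/

set_option autoImplicit false

noncomputable section

open Set Function Filter Matrix TopologicalSpace
open scoped Manifold ContDiff Topology

namespace Literature.AlgebraicGeometry.ShimuraVarieties

open Literature.AlgebraicGeometry.Motives (ComplexPoints AlgPoints SchemeOver)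
open Literature.NumberTheory.Transcendental
open Literature.NumberTheory.Automorphic (siegelUpperHalfSpace)
open Literature.Analysis.Complex

namespace UnitaryBallUniformisationDatum

variable {p : ℕ} {Y : SchemeOver ℂ} (D : UnitaryBallUniformisationDatum p Y)
  {E : Type} [NormedAddCommGroup E] [NormedSpace ℂ E] [FiniteDimensional ℂ E]
  {M : Type} [TopologicalSpace M] [ChartedSpace E M] [IsManifold 𝓘(ℂ, E) ω M]
  {φ : M → ComplexPoints Y}

/-! ### §0. The slice `v₀ + {e : e i₀ = 0}` (private twins of the helpers of ★ `UnitaryBallUniformisationLocalSection`) -/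

/-- A negative vector has a non-zero coordinate. [folklore] -/
private theorem exists_apply_ne_zero_of_mem_cone_an {v : Fin (p + 1) → ℂ} (hv : v ∈ D.cone) : ∃ i, v i ≠ 0 := by
  by_contra h
  have hv0 : v = 0 := funext fun i => not_not.1 fun hi => h ⟨i, hi⟩
  rw [hv0, mem_negCone_iff] at hv
  simp at hv

/-- The coordinate hyperplane `{e : e i₀ = 0}` of `ℂ^{p+1}` has dimension `p`. [folklore] -/
private theorem finrank_ker_proj_an (i₀ : Fin (p + 1)) :
    Module.finrank ℂ ↥(LinearMap.ker (LinearMap.proj i₀ : (Fin (p + 1) → ℂ) →ₗ[ℂ] ℂ)) = p := by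
  have h := LinearMap.finrank_range_add_finrank_ker (LinearMap.proj i₀ : (Fin (p + 1) → ℂ) →ₗ[ℂ] ℂ)
  rw [LinearMap.range_eq_top.2 (LinearMap.proj_surjective i₀), finrank_top, Module.finrank_self,
    Module.finrank_fin_fun] at h
  omega

/-- On the slice `v₀ + {e : e i₀ = 0}` with `v₀ i₀ ≠ 0`, two points on the same complex line are equal. [folklore] -/
private theorem eq_of_add_eq_smul_add_an {i₀ : Fin (p + 1)} {v₀ : Fin (p + 1) → ℂ} (hv₀ : v₀ i₀ ≠ 0)
    {e e' : ↥(LinearMap.ker (LinearMap.proj i₀ : (Fin (p + 1) → ℂ) →ₗ[ℂ] ℂ))} {c : ℂ}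
    (h : v₀ + (e : Fin (p + 1) → ℂ) = c • (v₀ + (e' : Fin (p + 1) → ℂ))) : e = e' := by
  have he : (e : Fin (p + 1) → ℂ) i₀ = 0 := e.2
  have he' : (e' : Fin (p + 1) → ℂ) i₀ = 0 := e'.2
  have hi := congrFun h i₀
  simp only [Pi.add_apply, Pi.smul_apply, smul_eq_mul, he, he', add_zero] at hi
  have hc : c = 1 := by
    have : (c - 1) * v₀ i₀ = 0 := by rw [sub_mul, one_mul, ← hi, sub_self]
    rcases mul_eq_zero.1 this with h1 | h1
    · exact (sub_eq_zero.1 h1)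
    · exact absurd h1 hv₀
  rw [hc, one_smul] at h
  exact Subtype.ext (add_left_cancel h)

/-! ### §1. The lift `φ⁻¹ ∘ unif` is holomorphic on the cone, for any analytification -/

/-- **The uniformisation read in ANY analytification `φ : M → Y(ℂ)` is holomorphic on the negative cone**: `φ⁻¹ ∘ unif` is
complex-differentiable at every cone vector (★ `IsAnalytification.mdifferentiableAt_symm_comp` on the datum's `continuousOn_unif` ∕
`differentiableOn_unif`; the ★ twin `mdifferentiableAt_symm_comp_unif` is the case of a Hodge model).
[cite: SerreGAGA1956, §2 n°6 Prop. 3 Cor. 2] [cite: BergeronMillsonMoeglin2016Balls, Introduction §1.1] -/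
theorem mdifferentiableAt_symm_comp_unif_of_isAnalytification (hφ : IsAnalytification E Y p φ) {v : Fin (p + 1) → ℂ}
    (hv : v ∈ D.cone) : MDifferentiableAt 𝓘(ℂ, Fin (p + 1) → ℂ) 𝓘(ℂ, E) (hφ.homeomorph.symm ∘ D.unif) v := by
  haveI := D.isSmoothProjective.smoothOfRelativeDimension
  exact hφ.mdifferentiableAt_symm_comp (isOpen_negCone _) D.continuousOn_unif D.differentiableOn_unif hv

/-- The lift along an affine slice `e ↦ φ⁻¹ (unif (v₀ + e))` (`e` in a linear subspace `S ≤ ℂ^{p+1}`) is holomorphic at every `e` with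
`v₀ + e` in the cone (any analytification). [cite: SerreGAGA1956, §2 n°6 Prop. 3 Cor. 2] -/
theorem mdifferentiableAt_symm_comp_unif_add_of_isAnalytification (hφ : IsAnalytification E Y p φ)
    (S : Submodule ℂ (Fin (p + 1) → ℂ)) (v₀ : Fin (p + 1) → ℂ) {e : ↥S} (he : v₀ + (e : Fin (p + 1) → ℂ) ∈ D.cone) :
    MDifferentiableAt 𝓘(ℂ, ↥S) 𝓘(ℂ, E) (fun e' : ↥S => hφ.homeomorph.symm (D.unif (v₀ + (e' : Fin (p + 1) → ℂ)))) e := by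
  have hα : MDifferentiableAt 𝓘(ℂ, ↥S) 𝓘(ℂ, Fin (p + 1) → ℂ) (fun e' : ↥S => v₀ + (e' : Fin (p + 1) → ℂ)) e :=
    mdifferentiableAt_iff_differentiableAt.2 ((differentiableAt_const v₀).add S.subtypeL.differentiableAt)
  have h : MDifferentiableAt 𝓘(ℂ, ↥S) 𝓘(ℂ, E) ((hφ.homeomorph.symm ∘ D.unif) ∘ fun e' : ↥S => v₀ + (e' : Fin (p + 1) → ℂ)) e :=
    (D.mdifferentiableAt_symm_comp_unif_of_isAnalytification hφ he).comp e hα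
  exact h

/-! ### §2. Holomorphic local sections through a cone vector near which `unif` is injective modulo `ℂˣ` -/

/-- **Holomorphic local sections of the uniformisation, through any analytification** (any rank `p`, any model space `E`).  Let `v₀` be
a negative vector near which `unif` is injective modulo `ℂˣ`.  Then there are an open `W ∋ x₀ := φ⁻¹(unif v₀)` of `M` and
`σ : M → ℂ^{p+1}` with `σ x₀ = v₀`, `σ y ∈ negCone` and `unif (σ y) = φ y` for `y ∈ W`, and `σ` complex-differentiable at every point
of `W` — VERBATIM the argument of ★ `exists_mdifferentiableAt_section` (slice ∘ local inverse ∘ chart; Clements–Osgood ★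
`SCV.isOpen_image_of_injOn` ∕ ★ `SCV.differentiableOn_symm_of_differentiableOn`), with the Hodge model replaced by `(E, M, φ)`.
[cite: FritzscheGrauert2002, Ch. I §8 Thm. 8.5 and Cor. 8.6] [cite: BergeronMillsonMoeglin2016Balls, Introduction §1.1] -/
theorem exists_mdifferentiableAt_section_of_isAnalytification (hφ : IsAnalytification E Y p φ) {v₀ : Fin (p + 1) → ℂ}
    (hv₀ : v₀ ∈ D.cone)
    (hinj : ∃ U : Set (Fin (p + 1) → ℂ), IsOpen U ∧ v₀ ∈ U ∧
      ∀ v ∈ U, ∀ w ∈ U, v ∈ D.cone → w ∈ D.cone → D.unif v = D.unif w → ∃ c : ℂ, v = c • w) :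
    ∃ (W : Set M) (σ : M → (Fin (p + 1) → ℂ)), IsOpen W ∧
      hφ.homeomorph.symm (D.unif v₀) ∈ W ∧
      σ (hφ.homeomorph.symm (D.unif v₀)) = v₀ ∧
      (∀ y ∈ W, σ y ∈ D.cone ∧ D.unif (σ y) = φ y) ∧
      ∀ y ∈ W, MDifferentiableAt 𝓘(ℂ, E) 𝓘(ℂ, Fin (p + 1) → ℂ) σ y := by
  -- adapted from ★ `UnitaryBallUniformisationLocalSection.exists_mdifferentiableAt_section` (A.model ↦ E, A.carrier ↦ M)
  classical
  obtain ⟨U, hUo, hv₀U, hU⟩ := hinj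
  obtain ⟨i₀, hi₀⟩ := D.exists_apply_ne_zero_of_mem_cone_an hv₀
  -- the slice `S = {e : e i₀ = 0}` and the affine parametrisation `α e = v₀ + e`
  set S : Submodule ℂ (Fin (p + 1) → ℂ) := LinearMap.ker (LinearMap.proj i₀ : (Fin (p + 1) → ℂ) →ₗ[ℂ] ℂ) with hS
  set α : ↥S → (Fin (p + 1) → ℂ) := fun e => v₀ + (e : Fin (p + 1) → ℂ) with hα
  have hαc : Continuous α := continuous_const.add continuous_subtype_val
  have hαd : Differentiable ℂ α := fun e => (differentiableAt_const v₀).add S.subtypeL.differentiableAt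
  have hα0 : α 0 = v₀ := by simp [hα]
  -- the analytification, the base point, the chart
  set ψ := hφ.homeomorph with hψ
  set u : (Fin (p + 1) → ℂ) → M := fun v => ψ.symm (D.unif v) with hu
  set x₀ : M := ψ.symm (D.unif v₀) with hx₀
  set ch := extChartAt 𝓘(ℂ, E) x₀ with hch
  -- the open set `O ∋ 0` of the slice on which `Yf = ch ∘ u ∘ α` is an injective holomorphic map
  have hcont : ContinuousOn (u ∘ α) (α ⁻¹' (U ∩ D.cone)) := by
    refine (ψ.symm.continuous.comp_continuousOn (D.continuousOn_unif.comp hαc.continuousOn ?_))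
    intro e he; exact he.2
  set O : Set ↥S := α ⁻¹' (U ∩ D.cone) ∩ (u ∘ α) ⁻¹' (chartAt E x₀).source with hO
  have hOo : IsOpen O :=
    hcont.isOpen_inter_preimage ((hUo.inter (isOpen_negCone _)).preimage hαc) (chartAt E x₀).open_source
  have h0O : (0 : ↥S) ∈ O := by
    refine ⟨?_, ?_⟩
    · show α 0 ∈ U ∩ D.cone; rw [hα0]; exact ⟨hv₀U, hv₀⟩
    · show u (α 0) ∈ (chartAt E x₀).source; rw [hα0]; exact mem_chart_source _ x₀
  have hOcone : ∀ e ∈ O, α e ∈ D.cone := fun e he => he.1.2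
  have hOU : ∀ e ∈ O, α e ∈ U := fun e he => he.1.1
  have hsrc : ∀ e ∈ O, u (α e) ∈ ch.source := fun e he => by
    rw [hch, extChartAt_source]; exact he.2
  set Yf : ↥S → E := fun e => ch (u (α e)) with hYf
  have hud : ∀ e ∈ O, MDifferentiableAt 𝓘(ℂ, ↥S) 𝓘(ℂ, E) (u ∘ α) e := fun e he =>
    D.mdifferentiableAt_symm_comp_unif_add_of_isAnalytification hφ S v₀ (hOcone e he)
  have hYd : DifferentiableOn ℂ Yf O := fun e he => by
    have h2 : MDifferentiableAt 𝓘(ℂ, E) 𝓘(ℂ, E) (extChartAt 𝓘(ℂ, E) x₀) ((u ∘ α) e) :=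
      mdifferentiableAt_extChartAt he.2
    exact (mdifferentiableAt_iff_differentiableAt.1 (h2.comp e (hud e he))).differentiableWithinAt
  have hYinj : InjOn Yf O := by
    intro e he e' he' h
    have h1 : u (α e) = u (α e') := ch.injOn (hsrc e he) (hsrc e' he') h
    have h2 : D.unif (α e) = D.unif (α e') := ψ.symm.injective h1
    obtain ⟨c, hc⟩ := hU (α e) (hOU e he) (α e') (hOU e' he') (hOcone e he) (hOcone e' he') h2
    exact eq_of_add_eq_smul_add_an hi₀ hc
  have hdim : Module.finrank ℂ ↥S = Module.finrank ℂ E := by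
    rw [hS, finrank_ker_proj_an, hφ.finrank_eq]
  -- `Yf : O → Yf(O)` is an open partial homeomorphism with holomorphic inverse (Clements–Osgood)
  haveI : Nonempty ↥S := ⟨0⟩
  set e₀ : PartialEquiv ↥S E := hYinj.toPartialEquiv Yf O with he₀
  have hopen : IsOpenMap (O.restrict Yf) := by
    intro s hs
    obtain ⟨V, hV, rfl⟩ := isOpen_induced_iff.1 hs
    have himg : O.restrict Yf '' (Subtype.val ⁻¹' V) = Yf '' (O ∩ V) := by
      ext y
      constructor
      · rintro ⟨⟨w, hwO⟩, hwV, rfl⟩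
        exact ⟨w, ⟨hwO, hwV⟩, rfl⟩
      · rintro ⟨w, ⟨hwO, hwV⟩, rfl⟩
        exact ⟨⟨w, hwO⟩, hwV, rfl⟩
    rw [himg]
    exact SCV.isOpen_image_of_injOn hdim (hYd.mono inter_subset_left) (hOo.inter hV)
      (hYinj.mono inter_subset_left)
  set T : OpenPartialHomeomorph ↥S E :=
    OpenPartialHomeomorph.ofContinuousOpenRestrict e₀ hYd.continuousOn hopen hOo with hT
  have hTd : DifferentiableOn ℂ T T.source := hYd
  have hWo : IsOpen (Yf '' O) := SCV.isOpen_image_of_injOn hdim hYd hOo hYinj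
  have hgd : DifferentiableOn ℂ T.symm (Yf '' O) :=
    SCV.differentiableOn_symm_of_differentiableOn hdim T hTd
  -- the section `σ = α ∘ T⁻¹ ∘ ch` on `W = ch.source ∩ ch⁻¹' Yf(O)`
  set W : Set M := ch.source ∩ ch ⁻¹' (Yf '' O) with hW
  have hWopen : IsOpen W := by
    rw [hW, hch]
    exact (continuousOn_extChartAt x₀).isOpen_inter_preimage (isOpen_extChartAt_source x₀) hWo
  have hx₀W : x₀ ∈ W := by
    refine ⟨by rw [hch]; exact mem_extChartAt_source x₀, ?_⟩
    show ch x₀ ∈ Yf '' O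
    refine ⟨0, h0O, ?_⟩
    show ch (u (α 0)) = ch x₀
    rw [hα0]
  set σ : M → (Fin (p + 1) → ℂ) := fun y => α (T.symm (ch y)) with hσ
  have hTsymm_mem : ∀ y ∈ W, T.symm (ch y) ∈ O := fun y hy => T.map_target hy.2
  have hsec : ∀ y ∈ W, u (σ y) = y := by
    intro y hy
    have hright : Yf (T.symm (ch y)) = ch y := T.right_inv hy.2
    have h1 : ch (u (σ y)) = ch y := hright
    exact ch.injOn (hsrc _ (hTsymm_mem y hy)) hy.1 h1
  refine ⟨W, σ, hWopen, hx₀W, ?_, fun y hy => ⟨hOcone _ (hTsymm_mem y hy), ?_⟩, fun y hy => ?_⟩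
  · -- `σ x₀ = v₀`
    show α (T.symm (ch x₀)) = v₀
    have : ch x₀ = Yf 0 := by show ch x₀ = ch (u (α 0)); rw [hα0]
    rw [this]
    have h0 : T.symm (Yf 0) = 0 := T.left_inv h0O
    rw [h0, hα0]
  · -- `unif (σ y) = φ y`
    have h := congrArg ψ (hsec y hy)
    simp only [hu, Homeomorph.apply_symm_apply] at h
    rw [h, hψ, IsAnalytification.coe_homeomorph]
  · -- holomorphy of `σ` at `y ∈ W`
    have hchd : MDifferentiableAt 𝓘(ℂ, E) 𝓘(ℂ, E) ch y := by
      rw [hch]; refine mdifferentiableAt_extChartAt ?_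
      have := hy.1; rwa [hch, extChartAt_source] at this
    have hTs : MDifferentiableAt 𝓘(ℂ, E) 𝓘(ℂ, ↥S) T.symm (ch y) :=
      mdifferentiableAt_iff_differentiableAt.2 (hgd.differentiableAt (hWo.mem_nhds hy.2))
    have hαm : MDifferentiableAt 𝓘(ℂ, ↥S) 𝓘(ℂ, Fin (p + 1) → ℂ) α (T.symm (ch y)) :=
      mdifferentiableAt_iff_differentiableAt.2 (hαd _)
    have hTch : MDifferentiableAt 𝓘(ℂ, E) 𝓘(ℂ, ↥S) (T.symm ∘ ch) y := hTs.comp y hchd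
    have hcomp : MDifferentiableAt 𝓘(ℂ, E) 𝓘(ℂ, Fin (p + 1) → ℂ) (α ∘ (T.symm ∘ ch)) y := hαm.comp y hTch
    exact hcomp

/-! ### §3. The injectivity hypothesis holds everywhere: sections through every cone vector -/

/-- **Holomorphic local sections of the uniformisation exist through every negative vector, in every rank and for EVERY analytification**
(§2 with `hinj` discharged by ★ `exists_isOpen_unif_eq_unif_imp_smul`, the proper discontinuity of the torsion-free `Γ` on the
projectivised cone). [cite: FritzscheGrauert2002, Ch. I §8 Thm. 8.5 and Cor. 8.6] [cite: Borel1969, Prop. 7.13]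
[cite: BergeronMillsonMoeglin2016Balls, Introduction §1.1] -/
theorem exists_mdifferentiableAt_section_of_isAnalytification' (hφ : IsAnalytification E Y p φ) {v₀ : Fin (p + 1) → ℂ}
    (hv₀ : v₀ ∈ D.cone) :
    ∃ (W : Set M) (σ : M → (Fin (p + 1) → ℂ)), IsOpen W ∧
      hφ.homeomorph.symm (D.unif v₀) ∈ W ∧
      σ (hφ.homeomorph.symm (D.unif v₀)) = v₀ ∧
      (∀ y ∈ W, σ y ∈ D.cone ∧ D.unif (σ y) = φ y) ∧
      ∀ y ∈ W, MDifferentiableAt 𝓘(ℂ, E) 𝓘(ℂ, Fin (p + 1) → ℂ) σ y :=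
  D.exists_mdifferentiableAt_section_of_isAnalytification hφ hv₀ (D.exists_isOpen_unif_eq_unif_imp_smul hv₀)

/-! ### §4. Section domains cover the analytification -/

/-- **Through every point `t` of ANY analytification of the ball quotient there is a holomorphic local section of the uniformisation**:
an open `W ∋ t` and `σ : M → ℂ^{p+1}`, complex-differentiable at every point of `W`, with `σ(W) ⊆ negCone` and `unif (σ y) = φ y` on `W`
(`unif` is onto, field `surjOn_unif`; then §3) — the `hcov` shape of ★ E6-an′ `exists_isMonHom_of_chartReadings_of_additive` for the cover of
`M` by section domains. [cite: FritzscheGrauert2002, Ch. I §8 Thm. 8.5 and Cor. 8.6] [cite: BergeronMillsonMoeglin2016Balls, Introduction §1.1] -/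
theorem exists_section_nhds_of_isAnalytification (hφ : IsAnalytification E Y p φ) (t : M) :
    ∃ (W : Set M) (σ : M → (Fin (p + 1) → ℂ)), IsOpen W ∧ t ∈ W ∧
      (∀ y ∈ W, σ y ∈ D.cone ∧ D.unif (σ y) = φ y) ∧
      ∀ y ∈ W, MDifferentiableAt 𝓘(ℂ, E) 𝓘(ℂ, Fin (p + 1) → ℂ) σ y := by
  obtain ⟨v₀, hv₀, hv₀t⟩ := D.surjOn_unif (mem_univ (φ t))
  obtain ⟨W, σ, hWo, htW, -, hσ, hσd⟩ := D.exists_mdifferentiableAt_section_of_isAnalytification' hφ hv₀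
  have ht : hφ.homeomorph.symm (D.unif v₀) = t := by
    rw [hv₀t]
    exact hφ.homeomorph.symm_apply_apply t
  rw [ht] at htW
  exact ⟨W, σ, hWo, htW, hσ, hσd⟩

/-! ### §5. The Siegel lift along a section: the P-3 binder block at every point -/

/-- **The P-3 lift data at every point of the analytification.**  Let `Z : ℂ^{p+1} → M_g(ℂ)` be entrywise holomorphic and `𝔥_g`-valued on
the negative cone (the period function of a slice, ★ `AuxChartGS.Z_hol` ∕ `Z_mem`), `unif_c : 𝔥_g → S_c(ℂ)` and `ψ : Y ⟶ S_c` with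
`unif_c (Z v) = ψ (unif v)` on the cone (★ E6-fac `exists_hom_piece_factor_of_holomorphicSiegelLift`, clause 1).  Then through every point
`t` of ANY analytification `φ : M → Y(ℂ)` there are an open `U ∋ t`, a section `σ` (in the cone, `unif ∘ σ = φ`, complex-differentiable on
`U`) and the lift `s := Z ∘ σ` with: `s y ∈ 𝔥_g`, every entry `y ↦ s y i j` `MDifferentiableOn U`, and `unif_c (s y) = ψ (φ y)` for `y ∈ U`
— token for token the last binder block `(U) (_ : IsOpen U) (s) (hs) (_ : ∀ i j, MDifferentiableOn … U) (_ : ∀ t ∈ U, unif (s t) = AlgPoints.map ψ (φT t))`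
of ★ P-3 `siegelUniversalFamilyUniformisation`, plus the `(σ, hσW, hσ)` binders of ★ `SiegelPeriodLinearAvatarFamily.exists_clm_family_along_lift`.
[cite: FritzscheGrauert2002, Ch. I §8 Thm. 8.5 and Cor. 8.6] [cite: BergeronMillsonMoeglin2016Balls, Introduction §1.1 and Part 2 §1.3] -/
theorem exists_siegelLift_nhds_of_isAnalytification (hφ : IsAnalytification E Y p φ) {g : ℕ} {Sc : SchemeOver ℂ}
    (Z : (Fin (p + 1) → ℂ) → Matrix (Fin g) (Fin g) ℂ) (Z_hol : ∀ i j, DifferentiableOn ℂ (fun v => Z v i j) D.cone)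
    (Z_mem : ∀ v, v ∈ D.cone → Z v ∈ siegelUpperHalfSpace g)
    (unifc : Matrix (Fin g) (Fin g) ℂ → ComplexPoints Sc) (ψ : Y ⟶ Sc)
    (hψ : ∀ v, v ∈ D.cone → AlgPoints.map ψ (D.unif v) = unifc (Z v)) (t : M) :
    ∃ (U : Set M) (σ : M → (Fin (p + 1) → ℂ)), IsOpen U ∧ t ∈ U ∧
      (∀ y ∈ U, σ y ∈ D.cone ∧ D.unif (σ y) = φ y) ∧
      (∀ y ∈ U, MDifferentiableAt 𝓘(ℂ, E) 𝓘(ℂ, Fin (p + 1) → ℂ) σ y) ∧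
      (∀ y ∈ U, Z (σ y) ∈ siegelUpperHalfSpace g) ∧
      (∀ i j, MDifferentiableOn 𝓘(ℂ, E) 𝓘(ℂ, ℂ) (fun y => Z (σ y) i j) U) ∧
      ∀ y ∈ U, unifc (Z (σ y)) = AlgPoints.map ψ (φ y) := by
  obtain ⟨U, σ, hUo, htU, hσ, hσd⟩ := D.exists_section_nhds_of_isAnalytification hφ t
  refine ⟨U, σ, hUo, htU, hσ, hσd, fun y hy => Z_mem _ (hσ y hy).1, fun i j y hy => ?_, fun y hy => ?_⟩
  · -- holomorphy of the entry `y ↦ Z (σ y) i j` at `y ∈ U`: a holomorphic function of the cone after a holomorphic section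
    have hZ : MDifferentiableAt 𝓘(ℂ, Fin (p + 1) → ℂ) 𝓘(ℂ, ℂ) (fun v => Z v i j) (σ y) :=
      mdifferentiableAt_iff_differentiableAt.2 ((Z_hol i j).differentiableAt ((isOpen_negCone _).mem_nhds (hσ y hy).1))
    exact (hZ.comp y (hσd y hy)).mdifferentiableWithinAt
  · rw [← hψ _ (hσ y hy).1, (hσ y hy).2]

end UnitaryBallUniformisationDatum

end Literature.AlgebraicGeometry.ShimuraVarieties

end
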